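import Summits.QuantumFields.YangMills.Theorems.PoincareLipschitzSobolevInversionPoleExtension
import HarnessLib

/-!
# W-INV assembled: the Wente ∕ H-system triple transports under the planar inversion (ROAD (W), brick W-INV, part 6)

Helper file (K2 lane of crux `stmt-QuantumFields-19936` `HistoryTailL` ∕ crux `stmt-QuantumFields-23533`
`BlockLipschitzL`, LINE 25 «CompactnessTransfer», ROAD (W) «the H-system energy gap at `3π` from the
sharp two-point Wente bound», brick W-INV).  YM₃ on the unit 3-torus is rung R3 of the ladder — NOT
`d = 4`, NOT infinite volume, NOT a mass gap, NOT the Clay problem; nothing here bears on those.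

`E² = EuclideanSpace ℝ (Fin 2)`, `e k = EuclideanSpace.single k 1`, `M = EuclideanGeometry.inversion c 1`,
`ũ = u ∘ M`, `G̃u(y) = Gu(M y) ∘L DM(y)`.  In the letters of the W-ONE socket (ym-ust-19936-w7 g15, `hu ha hb
hu2 ha2 hb2 hGa hGb hEq`) plus the DECAY rows of W-ONE (d) (`∫_{‖x−c‖>1} u² ‖x−c‖⁻⁴ < ∞`, likewise for
`a`, `b`) and the energy row for `u`:

* `integrableOn_sq_comp_inversion_of_decay` — the decay row says exactly `ũ ∈ L²(B(c,1))`;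
* `transport_comp_inversion` — ONE function: `HasWeakFDerivOn ⟨univ⟩ ũ G̃u`, `Σ_k(G̃u e_k)²`
  integrable with the same integral, `ũ² ∈ L¹_loc`;
* **`wenteTriple_comp_inversion`** — THE W-INV THEOREM: the admissible triple `(u; a, b)` on the plane
  is carried to the admissible triple `(ũ; b̃, ã)` (swap = orientation reversal) with EQUAL energies
  and the Wente row for every compactly supported smooth test function — the (INV) row of W-TWO
  (px22 g8) once W-ONE's decay lemma supplies the three decay rows.

References: H. Brezis, J.-M. Coron, Arch. Rational Mech. Anal. 89 (1985), Appendix p. 48 (the inversion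
`ω̃(x) = ω(x/|x|²)` and «a standard argument leads to `ω̃ ∈ H¹_loc(ℝ²)` and the equation in `𝒟′(ℝ²)`»);
P. Topping, *The optimal constant in Wente's `L^∞` estimate*, Comment. Math. Helv. 72 (1997).
-/

noncomputable section

open MeasureTheory Set Filter Metric Module EuclideanGeometry TopologicalSpace
open scoped ENNReal Topology RealInnerProductSpace ContDiff

namespace Summit.QuantumFields.YangMills.Theorems.PoincareLipschitzSobolevInversion

open Literature.Analysis.FunctionSpaces

/-! ## §1 The decay row is `L²` near the pole after inversion -/

/-- **Decay ⇒ `L²` near the pole**: if `x ↦ u(x)² ‖x−c‖⁻⁴` is integrable on `{1 < dist x c}` then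
`(u ∘ M)²` is integrable on `B(c, 1)` (change of variables; `M` maps `B(c,1) ∖ {c}` onto `{1 < dist x c}`).
[folklore] -/
theorem integrableOn_sq_comp_inversion_of_decay {c : EuclideanSpace ℝ (Fin 2)} {u : EuclideanSpace ℝ (Fin 2) → ℝ}
    (hd : IntegrableOn (fun x => u x ^ 2 * ((‖x - c‖ ^ 2)⁻¹) ^ 2) {x | 1 < dist x c}) :
    IntegrableOn (fun y => (u (inversion c 1 y)) ^ 2) (ball c 1) := by
  -- the change of variables in the form `∫ F(M y) dy = ∫ ‖x-c‖⁻⁴ F(x) dx` for `F = 1_{1 < dist} · u²∘?`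
  set F : EuclideanSpace ℝ (Fin 2) → ℝ := fun x => ({x | 1 < dist x c} : Set _).indicator (fun x => u x ^ 2) x
    with hF
  have hJF : Integrable (fun x => (((‖x - c‖ ^ 2)⁻¹) ^ 2) • F x) := by
    have h := hd.integrable_indicator (measurableSet_lt measurable_const (measurable_id.dist measurable_const))
    refine h.congr (Eventually.of_forall fun x => ?_)
    simp only [hF, smul_eq_mul]
    by_cases hx : x ∈ ({x | 1 < dist x c} : Set (EuclideanSpace ℝ (Fin 2)))
    · rw [indicator_of_mem hx, indicator_of_mem hx]; ring
    · rw [indicator_of_notMem hx, indicator_of_notMem hx, mul_zero]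
  -- `Integrable (J • (J∘M • F∘M)) ↔ Integrable (J∘M • F∘M)`... use the iff with `g := J • F`: then
  -- `y ↦ J y • (J • F) (M y) = F (M y)` a.e.
  have h2 := (integrable_comp_inversion_iff c (fun x => (((‖x - c‖ ^ 2)⁻¹) ^ 2) • F x)).2 hJF
  have h3 : Integrable (fun y => F (inversion c 1 y)) := by
    refine h2.congr ?_
    filter_upwards [Measure.ae_ne volume c] with y hy
    have h0 : ‖y - c‖ ≠ 0 := norm_ne_zero_iff.2 (sub_ne_zero.2 hy)
    simp only [smul_eq_mul, norm_inversion_sub_center_sq hy, inv_inv]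
    field_simp
  -- `F ∘ M = 1_{ball c 1} · (u∘M)²` away from `c`
  rw [← integrable_indicator_iff measurableSet_ball]
  refine h3.congr ?_
  filter_upwards [Measure.ae_ne volume c] with y hy
  have hpos : 0 < dist y c := dist_pos.2 hy
  simp only [hF]
  by_cases hy1 : y ∈ ball c 1
  · have : inversion c 1 y ∈ ({x | 1 < dist x c} : Set (EuclideanSpace ℝ (Fin 2))) := by
      show 1 < dist (inversion c 1 y) c
      rw [dist_inversion_center, one_pow, one_div]
      exact one_lt_inv_iff₀.2 ⟨hpos, mem_ball.1 hy1⟩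
    rw [indicator_of_mem this, indicator_of_mem hy1]
  · have : inversion c 1 y ∉ ({x | 1 < dist x c} : Set (EuclideanSpace ℝ (Fin 2))) := by
      show ¬ 1 < dist (inversion c 1 y) c
      rw [dist_inversion_center, one_pow, one_div, not_lt]
      exact inv_le_one_of_one_le₀ (not_lt.1 fun h => hy1 (mem_ball.2 h))
    rw [indicator_of_notMem this, indicator_of_notMem hy1]

/-! ## §2 One function -/

/-- **Transport of one function under the inversion** (W-INV for a single `W^{1,2}`-type function with
finite energy, `L²_loc`, and the decay row): `ũ = u ∘ M` has the weak derivative `G̃u = Gu(M·) ∘L DM`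
on the WHOLE plane, the energy `Σ_k (G̃u e_k)²` is integrable with the same integral, and `ũ² ∈ L¹_loc`.
[cite: BrezisCoron1985, Appendix p. 48 (inversion step)] -/
theorem transport_comp_inversion (c : EuclideanSpace ℝ (Fin 2)) {u : EuclideanSpace ℝ (Fin 2) → ℝ}
    {Gu : EuclideanSpace ℝ (Fin 2) → EuclideanSpace ℝ (Fin 2) →L[ℝ] ℝ}
    (hu : HasWeakFDerivOn ⟨univ, isOpen_univ⟩ volume u Gu)
    (hu2 : LocallyIntegrable (fun y => u y ^ 2) volume)
    (hGu : Integrable (fun y => ∑ k : Fin 2, (Gu y (EuclideanSpace.single k 1)) ^ 2))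
    (hd : IntegrableOn (fun x => u x ^ 2 * ((‖x - c‖ ^ 2)⁻¹) ^ 2) {x | 1 < dist x c}) :
    HasWeakFDerivOn ⟨univ, isOpen_univ⟩ volume (fun y => u (inversion c 1 y))
        (fun y => (Gu (inversion c 1 y)).comp (fderiv ℝ (inversion c 1) y)) ∧
      Integrable (fun y => ∑ k : Fin 2,
        ((Gu (inversion c 1 y)).comp (fderiv ℝ (inversion c 1) y) (EuclideanSpace.single k 1)) ^ 2) ∧
      (∫ y, ∑ k : Fin 2, ((Gu (inversion c 1 y)).comp (fderiv ℝ (inversion c 1) y) (EuclideanSpace.single k 1)) ^ 2) =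
        ∫ x, ∑ k : Fin 2, (Gu x (EuclideanSpace.single k 1)) ^ 2 ∧
      LocallyIntegrable (fun y => (u (inversion c 1 y)) ^ 2) volume := by
  -- off the pole
  have huc : HasWeakFDerivOn ⟨{c}ᶜ, isOpen_compl_singleton⟩ volume u Gu :=
    HasWeakFDerivOn.mono_set_holds hu (fun _ _ => trivial)
  have h1 := hasWeakFDerivOn_comp_inversion huc
  -- energy
  have hE := (integrable_energy_comp_inversion_iff c Gu).2 hGu
  -- the pole
  have hL2 : IntegrableOn (fun y => (u (inversion c 1 y)) ^ 2) (ball c 1) :=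
    integrableOn_sq_comp_inversion_of_decay hd
  have h2 := hasWeakFDerivOn_univ_of_compl_singleton h1 one_pos hL2 hE.integrableOn
  refine ⟨h2, hE, integral_energy_comp_inversion c Gu, ?_⟩
  -- `ũ² ∈ L¹_loc`: off the pole by transport of `u² ∈ L¹_loc`, near the pole by the decay row
  have h3 : LocallyIntegrableOn (fun y => (u (inversion c 1 y)) ^ 2) ({c}ᶜ : Set (EuclideanSpace ℝ (Fin 2))) volume :=
    locallyIntegrableOn_comp_inversion (u := fun y => u y ^ 2) (hu2.locallyIntegrableOn _)
  intro x
  by_cases hx : x = c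
  · subst hx; exact ⟨ball x 1, ball_mem_nhds x one_pos, hL2⟩
  · have h := h3 x hx
    rwa [IntegrableAtFilter, isOpen_compl_singleton.nhdsWithin_eq hx] at h

/-! ## §3 The triple -/

/-- **W-INV — the Wente ∕ H-system triple transports under the planar inversion.**  Let `(u; a, b)` be
an admissible triple on the plane in the letters of the W-ONE socket: weak derivatives `Gu, Ga, Gb` on
`univ`, `u², a², b² ∈ L¹_loc`, finite energies, and the Wente row
`−∫ Σ_k ∂_kη · Gu e_k = 2 ∫ η · (Ga e₀ · Gb e₁ − Ga e₁ · Gb e₀)` for all compactly supported smooth `η`;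
assume the DECAY rows `∫_{1 < dist x c} u² ‖x−c‖⁻⁴ < ∞` (likewise `a`, `b`; = W-ONE (d)).  Then the
inverted triple `(u∘M; b∘M, a∘M)` — NOTE THE SWAP, compensating the orientation reversal of `M` — with
the transported derivatives `G̃(y) = G(M y) ∘L DM(y)` is admissible in the same letters, with EQUAL
energies `∫ Σ_k (G̃ e_k)² = ∫ Σ_k (G e_k)²` for each of `u, a, b`.  This is the (INV) row of the
two-point knit W-TWO. [cite: BrezisCoron1985, Appendix p. 48 (inversion step)] -/
theorem wenteTriple_comp_inversion (c : EuclideanSpace ℝ (Fin 2)) {u a b : EuclideanSpace ℝ (Fin 2) → ℝ}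
    {Gu Ga Gb : EuclideanSpace ℝ (Fin 2) → EuclideanSpace ℝ (Fin 2) →L[ℝ] ℝ}
    (hu : HasWeakFDerivOn ⟨univ, isOpen_univ⟩ volume u Gu)
    (ha : HasWeakFDerivOn ⟨univ, isOpen_univ⟩ volume a Ga)
    (hb : HasWeakFDerivOn ⟨univ, isOpen_univ⟩ volume b Gb)
    (hu2 : LocallyIntegrable (fun y => u y ^ 2) volume) (ha2 : LocallyIntegrable (fun y => a y ^ 2) volume)
    (hb2 : LocallyIntegrable (fun y => b y ^ 2) volume)
    (hGu : Integrable (fun y => ∑ k : Fin 2, (Gu y (EuclideanSpace.single k 1)) ^ 2))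
    (hGa : Integrable (fun y => ∑ k : Fin 2, (Ga y (EuclideanSpace.single k 1)) ^ 2))
    (hGb : Integrable (fun y => ∑ k : Fin 2, (Gb y (EuclideanSpace.single k 1)) ^ 2))
    (hEq : ∀ η : EuclideanSpace ℝ (Fin 2) → ℝ, ContDiff ℝ ∞ η → HasCompactSupport η →
      -(∫ y, ∑ k : Fin 2, fderiv ℝ η y (EuclideanSpace.single k 1) * Gu y (EuclideanSpace.single k 1)) =
        2 * ∫ y, η y * (Ga y (EuclideanSpace.single 0 1) * Gb y (EuclideanSpace.single 1 1) -
          Ga y (EuclideanSpace.single 1 1) * Gb y (EuclideanSpace.single 0 1)))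
    (hdu : IntegrableOn (fun x => u x ^ 2 * ((‖x - c‖ ^ 2)⁻¹) ^ 2) {x | 1 < dist x c})
    (hda : IntegrableOn (fun x => a x ^ 2 * ((‖x - c‖ ^ 2)⁻¹) ^ 2) {x | 1 < dist x c})
    (hdb : IntegrableOn (fun x => b x ^ 2 * ((‖x - c‖ ^ 2)⁻¹) ^ 2) {x | 1 < dist x c}) :
    HasWeakFDerivOn ⟨univ, isOpen_univ⟩ volume (fun y => u (inversion c 1 y))
        (fun y => (Gu (inversion c 1 y)).comp (fderiv ℝ (inversion c 1) y)) ∧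
      HasWeakFDerivOn ⟨univ, isOpen_univ⟩ volume (fun y => b (inversion c 1 y))
        (fun y => (Gb (inversion c 1 y)).comp (fderiv ℝ (inversion c 1) y)) ∧
      HasWeakFDerivOn ⟨univ, isOpen_univ⟩ volume (fun y => a (inversion c 1 y))
        (fun y => (Ga (inversion c 1 y)).comp (fderiv ℝ (inversion c 1) y)) ∧
      LocallyIntegrable (fun y => (u (inversion c 1 y)) ^ 2) volume ∧
      LocallyIntegrable (fun y => (b (inversion c 1 y)) ^ 2) volume ∧
      LocallyIntegrable (fun y => (a (inversion c 1 y)) ^ 2) volume ∧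
      Integrable (fun y => ∑ k : Fin 2,
        ((Gu (inversion c 1 y)).comp (fderiv ℝ (inversion c 1) y) (EuclideanSpace.single k 1)) ^ 2) ∧
      Integrable (fun y => ∑ k : Fin 2,
        ((Gb (inversion c 1 y)).comp (fderiv ℝ (inversion c 1) y) (EuclideanSpace.single k 1)) ^ 2) ∧
      Integrable (fun y => ∑ k : Fin 2,
        ((Ga (inversion c 1 y)).comp (fderiv ℝ (inversion c 1) y) (EuclideanSpace.single k 1)) ^ 2) ∧
      (∫ y, ∑ k : Fin 2, ((Gu (inversion c 1 y)).comp (fderiv ℝ (inversion c 1) y) (EuclideanSpace.single k 1)) ^ 2) =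
        ∫ x, ∑ k : Fin 2, (Gu x (EuclideanSpace.single k 1)) ^ 2 ∧
      (∫ y, ∑ k : Fin 2, ((Gb (inversion c 1 y)).comp (fderiv ℝ (inversion c 1) y) (EuclideanSpace.single k 1)) ^ 2) =
        ∫ x, ∑ k : Fin 2, (Gb x (EuclideanSpace.single k 1)) ^ 2 ∧
      (∫ y, ∑ k : Fin 2, ((Ga (inversion c 1 y)).comp (fderiv ℝ (inversion c 1) y) (EuclideanSpace.single k 1)) ^ 2) =
        ∫ x, ∑ k : Fin 2, (Ga x (EuclideanSpace.single k 1)) ^ 2 ∧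
      ∀ η : EuclideanSpace ℝ (Fin 2) → ℝ, ContDiff ℝ ∞ η → HasCompactSupport η →
        -(∫ y, ∑ k : Fin 2, fderiv ℝ η y (EuclideanSpace.single k 1) *
            (Gu (inversion c 1 y)).comp (fderiv ℝ (inversion c 1) y) (EuclideanSpace.single k 1)) =
          2 * ∫ y, η y *
            ((Gb (inversion c 1 y)).comp (fderiv ℝ (inversion c 1) y) (EuclideanSpace.single 0 1) *
                (Ga (inversion c 1 y)).comp (fderiv ℝ (inversion c 1) y) (EuclideanSpace.single 1 1) -
              (Gb (inversion c 1 y)).comp (fderiv ℝ (inversion c 1) y) (EuclideanSpace.single 1 1) *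
                (Ga (inversion c 1 y)).comp (fderiv ℝ (inversion c 1) y) (EuclideanSpace.single 0 1)) := by
  obtain ⟨hU, hUE, hUI, hU2⟩ := transport_comp_inversion c hu hu2 hGu hdu
  obtain ⟨hA, hAE, hAI, hA2⟩ := transport_comp_inversion c ha ha2 hGa hda
  obtain ⟨hB, hBE, hBI, hB2⟩ := transport_comp_inversion c hb hb2 hGb hdb
  refine ⟨hU, hB, hA, hU2, hB2, hA2, hUE, hBE, hAE, hUI, hBI, hAI, ?_⟩
  -- the row off the pole, by the conformal identities of part 3
  have hrow := wenteRow_comp_inversion (c := c) (Gu := Gu) (Ga := Ga) (Gb := Gb)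
    (fun η hη => hEq η hη.contDiff hη.hasCompactSupport)
  -- measurability ∕ integrability data for the removable-pole lemma
  have hGm : AEStronglyMeasurable (fun y => (Gu (inversion c 1 y)).comp (fderiv ℝ (inversion c 1) y)) volume := by
    simpa using hU.locallyIntegrableOn_deriv.aestronglyMeasurable
  have hGloc : LocallyIntegrableOn (fun y => (Gu (inversion c 1 y)).comp (fderiv ℝ (inversion c 1) y))
      ({c}ᶜ : Set (EuclideanSpace ℝ (Fin 2))) volume :=
    hU.locallyIntegrableOn_deriv.mono_set (subset_univ _)
  -- the Jacobian `det(G̃b, G̃a)` is integrable: `|det| ≤ (e(b̃) + e(ã)) / 2`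
  set J : EuclideanSpace ℝ (Fin 2) → ℝ := fun y =>
    (Gb (inversion c 1 y)).comp (fderiv ℝ (inversion c 1) y) (EuclideanSpace.single 0 1) *
        (Ga (inversion c 1 y)).comp (fderiv ℝ (inversion c 1) y) (EuclideanSpace.single 1 1) -
      (Gb (inversion c 1 y)).comp (fderiv ℝ (inversion c 1) y) (EuclideanSpace.single 1 1) *
        (Ga (inversion c 1 y)).comp (fderiv ℝ (inversion c 1) y) (EuclideanSpace.single 0 1) with hJ
  have hBm : AEStronglyMeasurable (fun y => (Gb (inversion c 1 y)).comp (fderiv ℝ (inversion c 1) y)) volume := by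
    simpa using hB.locallyIntegrableOn_deriv.aestronglyMeasurable
  have hAm : AEStronglyMeasurable (fun y => (Ga (inversion c 1 y)).comp (fderiv ℝ (inversion c 1) y)) volume := by
    simpa using hA.locallyIntegrableOn_deriv.aestronglyMeasurable
  have hev : ∀ (k : Fin 2) {G : EuclideanSpace ℝ (Fin 2) → EuclideanSpace ℝ (Fin 2) →L[ℝ] ℝ},
      AEStronglyMeasurable G volume → AEStronglyMeasurable (fun y => G y (EuclideanSpace.single k 1)) volume :=
    fun k G hG => (ContinuousLinearMap.apply ℝ ℝ (EuclideanSpace.single k (1 : ℝ))).continuous.comp_aestronglyMeasurable hG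
  have hJi : Integrable J := by
    have hJm : AEStronglyMeasurable J volume :=
      ((hev 0 hBm).mul (hev 1 hAm)).sub ((hev 1 hBm).mul (hev 0 hAm))
    refine Integrable.mono' ((hBE.add hAE).div_const 2) hJm (Eventually.of_forall fun y => ?_)
    simp only [hJ, Fin.sum_univ_two, Fin.isValue, Real.norm_eq_abs, Pi.add_apply]
    -- `|p₀ q₁ - p₁ q₀| ≤ (p₀² + p₁² + q₀² + q₁²)/2`
    set p₀ := (Gb (inversion c 1 y)).comp (fderiv ℝ (inversion c 1) y) (EuclideanSpace.single 0 1)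
    set p₁ := (Gb (inversion c 1 y)).comp (fderiv ℝ (inversion c 1) y) (EuclideanSpace.single 1 1)
    set q₀ := (Ga (inversion c 1 y)).comp (fderiv ℝ (inversion c 1) y) (EuclideanSpace.single 0 1)
    set q₁ := (Ga (inversion c 1 y)).comp (fderiv ℝ (inversion c 1) y) (EuclideanSpace.single 1 1)
    rw [abs_le]
    constructor
    · nlinarith [sq_nonneg (p₀ + q₁), sq_nonneg (p₁ - q₀)]
    · nlinarith [sq_nonneg (p₀ - q₁), sq_nonneg (p₁ + q₀)]
  intro η hη hηs
  have h := wenteRow_univ_of_compl_singleton hGm hGloc one_pos hUE.integrableOn hJi.locallyIntegrable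
    (fun θ hθ => by simpa only [hJ] using hrow θ hθ) η hη hηs
  simpa only [hJ] using h

end Summit.QuantumFields.YangMills.Theorems.PoincareLipschitzSobolevInversion

end
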